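import Summits.QuantumAdvantage.AdviceFreeQNC0.WalkCoreBasics
import HarnessLib

/-!
# Cell qa-qnc0 (rung F-Q1, route RingFrame, crux α): E4 — an even triple is a two-position walk
# strategy of degree `D + 1` (planner qa-qnc0-p1 ROUND-9 §2, Sketch10 §22.2 `EvenTripleIsWalk`, ask P9)

* `evenTriple_isWalkRow : EvenTripleIsWalk` (statement VERBATIM): for an even triple `P` of degree
  `≤ D` on `ℓ ≥ 1` bits and any charge `c'`, the pattern `w ↦ P_{|w| mod 3}(w)` is the WIN pattern of
  the walk strategy `y₀ = P_{σ+2} ⊕ (P_σ ∧ w₀)`, `y₁ = P_σ`, `y_g = 0 (g ≥ 2)`, `σ ≡ −c'`, of degree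
  `≤ D + 1` — so a mixed strategy of degree `D` is a walk strategy of degree `D + 1` (with
  `ringWinU_xor`).  The residue bookkeeping is one `decide` (`key`; `sel3`).

WHAT THIS IS NOT: the hub `MixedHardPolylog ↔ WalkHardAll`, E2/E3/E6, W1–W3 are not in this file;
nothing on α.
-/

noncomputable section

namespace Summit.QuantumAdvantage.AdviceFreeQNC0

open Finset
open Literature.Computability.MetaComplexity Literature.Computability.MetaComplexity.Smolensky

/-- **E4** (verbatim from `Sketch10` §22.2). -/
def EvenTripleIsWalk : Prop :=
  ∀ ℓ : ℕ, 1 ≤ ℓ → ∀ c' D : ℕ, ∀ P : ℕ → (Fin ℓ → Bool) → Bool, IsEvenTriple D P →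
    IsWalkRow c' (D + 1) (fun w => P (wt w % 3) w)

/-- residue selector `(p₀, p₁, p₂)_{j mod 3}`. -/
def sel3 (p0 p1 p2 : Bool) (j : ℕ) : Bool := if j % 3 = 0 then p0 else if j % 3 = 1 then p1 else p2

/-- The residue bookkeeping of E4 (finite check). -/
private theorem key : ∀ (cm t : Fin 3) (b p0 p1 p2 : Bool), xor p0 (xor p1 p2) = false →
    decide (((if (xor (sel3 p0 p1 p2 ((3 - cm.val) % 3 + 2)) (sel3 p0 p1 p2 ((3 - cm.val) % 3) && b)) = true
              ∧ (cm.val + t.val) % 3 ≠ 0 then 1 else 0) +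
        (if sel3 p0 p1 p2 ((3 - cm.val) % 3) = true
              ∧ (cm.val + 1 + t.val + (if b = true then 1 else 0)) % 3 ≠ 0 then 1 else 0)) % 2 = 1) =
      sel3 p0 p1 p2 t.val := by
  decide

/-- `W_0(w) = 0`. -/
private theorem wtPrefix_zero' {ℓ : ℕ} (w : Fin ℓ → Bool) : wtPrefix w 0 = 0 := by
  unfold wtPrefix; simp

/-- `W_1(w) = [w₀]` (`ℓ ≥ 1`). -/
private theorem wtPrefix_one' {ℓ : ℕ} (hℓ : 1 ≤ ℓ) (w : Fin ℓ → Bool) :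
    wtPrefix w 1 = if w ⟨0, hℓ⟩ = true then 1 else 0 := by
  unfold wtPrefix
  have e : (univ.filter fun i : Fin ℓ => i.val < 1 ∧ w i = true) =
      if w ⟨0, hℓ⟩ = true then {⟨0, hℓ⟩} else ∅ := by
    ext i
    simp only [Finset.mem_filter, Finset.mem_univ, true_and, Nat.lt_one_iff]
    constructor
    · rintro ⟨hi, hw⟩
      have : i = ⟨0, hℓ⟩ := Fin.ext hi
      subst this
      rw [if_pos hw]; exact Finset.mem_singleton_self _
    · intro h
      split_ifs at h with hw
      · rw [Finset.mem_singleton] at h; subst h; exact ⟨rfl, hw⟩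
      · exact absurd h (Finset.notMem_empty _)
  rw [e]; split_ifs <;> simp

/-- A coordinate has degree `1`. -/
private theorem hasDeg_coord' {m : ℕ} (j : Fin m) : HasDeg (fun u : Fin m → Bool => u j) 1 := by
  unfold HasDeg
  have h : (fun x : Fin m → Bool => if x j = true then (1 : ZMod 2) else 0) = mono (ZMod 2) {j} := by
    funext x; rw [mono_apply]; simp
  rw [h]
  exact mono_mem_lowDeg (by simp)

/-- **E4 `EvenTripleIsWalk`.** -/
theorem evenTriple_isWalkRow : EvenTripleIsWalk := by
  intro ℓ hℓ c' D P hP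
  obtain ⟨hPdeg, hPeven⟩ := hP
  set i0 : Fin ℓ := ⟨0, hℓ⟩ with hi0
  set σ : ℕ := (3 - c' % 3) % 3 with hσ
  -- the two-position strategy
  set y : Fin (ℓ + 1) → (Fin ℓ → Bool) → Bool := fun g w =>
    if g.val = 0 then xor (P ((σ + 2) % 3) w) (P σ w && w i0)
    else if g.val = 1 then P σ w else false with hy
  refine ⟨y, fun g => ?_, fun w => ?_⟩
  · -- degrees
    by_cases h0 : g.val = 0
    · have e : y g = fun w => xor (P ((σ + 2) % 3) w) (P σ w && w i0) := by
        funext w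
        show (if g.val = 0 then xor (P ((σ + 2) % 3) w) (P σ w && w i0)
          else if g.val = 1 then P σ w else false) = _
        rw [if_pos h0]
      rw [e]
      exact hasDeg_xor (hasDeg_of_le (hPdeg _) (Nat.le_succ D)) (hasDeg_and (hPdeg σ) (hasDeg_coord' i0))
    · by_cases h1 : g.val = 1
      · have e : y g = P σ := by
          funext w
          show (if g.val = 0 then xor (P ((σ + 2) % 3) w) (P σ w && w i0)
            else if g.val = 1 then P σ w else false) = _
          rw [if_neg h0, if_pos h1]
        rw [e]; exact hasDeg_of_le (hPdeg σ) (Nat.le_succ D)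
      · have e : y g = fun _ => false := by
          funext w
          show (if g.val = 0 then xor (P ((σ + 2) % 3) w) (P σ w && w i0)
            else if g.val = 1 then P σ w else false) = _
          rw [if_neg h0, if_neg h1]
        rw [e]; exact hasDeg_false _
  · -- the win pattern
    have hℓ1 : 1 < ℓ + 1 := by omega
    set g0 : Fin (ℓ + 1) := ⟨0, by omega⟩ with hg0
    set g1 : Fin (ℓ + 1) := ⟨1, hℓ1⟩ with hg1
    have hv0 : g0.val = 0 := rfl
    have hv1 : g1.val = 1 := rfl
    have hg01 : g0 ≠ g1 := fun h => by have := congrArg Fin.val h; rw [hv0, hv1] at this; exact zero_ne_one this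
    show P (wt w % 3) w = ringWinU c' y w
    unfold ringWinU
    -- only positions `0` and `1` can be selected
    have hfilter : (univ.filter fun g : Fin (ℓ + 1) =>
        y g w = true ∧ (c' + g.val + walkExp w g.val) % 3 ≠ 0) =
        ({g0, g1} : Finset (Fin (ℓ + 1))).filter fun g =>
          y g w = true ∧ (c' + g.val + walkExp w g.val) % 3 ≠ 0 := by
      ext g
      simp only [Finset.mem_filter, Finset.mem_univ, true_and, Finset.mem_insert, Finset.mem_singleton]
      constructor
      · rintro ⟨hyg, hc⟩
        refine ⟨?_, hyg, hc⟩
        by_cases h0 : g.val = 0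
        · exact Or.inl (Fin.ext h0)
        · by_cases h1 : g.val = 1
          · exact Or.inr (Fin.ext h1)
          · simp only [hy, h0, h1, if_false] at hyg; exact absurd hyg Bool.false_ne_true
      · rintro ⟨-, hyg, hc⟩; exact ⟨hyg, hc⟩
    rw [hfilter]
    -- the two candidate positions, counted
    set Q : Fin (ℓ + 1) → Prop := fun g => y g w = true ∧ (c' + g.val + walkExp w g.val) % 3 ≠ 0 with hQ
    have hcard : (({g0, g1} : Finset (Fin (ℓ + 1))).filter Q).card =
        (if Q g0 then 1 else 0) + (if Q g1 then 1 else 0) := by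
      rw [Finset.filter_insert, Finset.filter_singleton]
      by_cases hQ0 : Q g0 <;> by_cases hQ1 : Q g1 <;> simp [hQ0, hQ1, hg01]
    rw [hcard]
    -- the values at positions `0` and `1`, in residues
    have hy0 : y g0 w = xor (P ((σ + 2) % 3) w) (P σ w && w i0) := by
      show (if g0.val = 0 then xor (P ((σ + 2) % 3) w) (P σ w && w i0)
        else if g0.val = 1 then P σ w else false) = _
      rw [if_pos hv0]
    have hy1 : y g1 w = P σ w := by
      show (if g1.val = 0 then xor (P ((σ + 2) % 3) w) (P σ w && w i0)
        else if g1.val = 1 then P σ w else false) = _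
      rw [if_neg (by rw [hv1]; exact one_ne_zero), if_pos hv1]
    have hE0 : walkExp w g0.val = wt w := by rw [hv0]; unfold walkExp; rw [wtPrefix_zero', add_zero]
    have hE1 : walkExp w g1.val = wt w + (if w i0 = true then 1 else 0) := by
      rw [hv1]; unfold walkExp; rw [wtPrefix_one' hℓ]
    have hQ0 : Q g0 ↔ ((xor (P ((σ + 2) % 3) w) (P σ w && w i0)) = true ∧ (c' % 3 + wt w % 3) % 3 ≠ 0) := by
      rw [hQ]; show (y g0 w = true ∧ _) ↔ _
      rw [hy0, hE0, hv0]
      constructor <;> rintro ⟨h1, h2⟩ <;> exact ⟨h1, by omega⟩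
    have hQ1 : Q g1 ↔ (P σ w = true ∧ (c' % 3 + 1 + wt w % 3 + (if w i0 = true then 1 else 0)) % 3 ≠ 0) := by
      rw [hQ]; show (y g1 w = true ∧ _) ↔ _
      rw [hy1, hE1, hv1]
      constructor <;> rintro ⟨h1, h2⟩ <;> refine ⟨h1, ?_⟩ <;> revert h2 <;>
        cases w i0 <;> simp <;> omega
    have hsum : ((if Q g0 then 1 else 0) + (if Q g1 then 1 else 0) : ℕ) =
        (if ((xor (P ((σ + 2) % 3) w) (P σ w && w i0)) = true ∧ (c' % 3 + wt w % 3) % 3 ≠ 0) then 1 else 0) +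
        (if (P σ w = true ∧ (c' % 3 + 1 + wt w % 3 + (if w i0 = true then 1 else 0)) % 3 ≠ 0) then 1 else 0) := by
      rw [if_congr hQ0 rfl rfl, if_congr hQ1 rfl rfl]
    rw [hsum]
    -- the selector values are the values of `P`
    have hsel : ∀ j, sel3 (P 0 w) (P 1 w) (P 2 w) j = P (j % 3) w := by
      intro j
      unfold sel3
      have hj : j % 3 = 0 ∨ j % 3 = 1 ∨ j % 3 = 2 := by omega
      rcases hj with h | h | h <;> simp [h]
    have K := key ⟨c' % 3, Nat.mod_lt _ (by norm_num)⟩ ⟨wt w % 3, Nat.mod_lt _ (by norm_num)⟩ (w i0)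
      (P 0 w) (P 1 w) (P 2 w) (hPeven w)
    simp only [hsel, Nat.mod_mod] at K
    rw [← hσ] at K
    exact K.symm

end Summit.QuantumAdvantage.AdviceFreeQNC0

end
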